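import Summits.QuantumFields.BalabanUV.Beta.CompositeVertexWardRooted
import Summits.QuantumFields.BalabanUV.Beta.CompositeVertexKernelRecTwo

/-!
# `BalabanUV.Beta.CompositeVertexWardRootedTwo` — row D1 ∕ (C1), PART 106a: THE COMPOSITE SECOND-ORDER BORDER WARD LAW BY INDUCTION ON THE DEPTH
# (generic bricks; then an1's rooted slot-symmetrised bricks): the middle-slot background divergence of the top-peeled composite second-order kernel IS the
# composite first-order vertex times the leg jump at the COMPOSED ROOT — the first letter (`hBordᴿ`, kernel level) of the (W)_j series under presentation (ᴿ)

HONEST DEPENDENCY (page 1, mandatory): continuum YM on T⁴ ⇐ BetaPertH ∧ nine spine estimates (0/9 proved); BetaPertH ⇐ (D1) ∧ (D4) ∧ CAP+tail;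
G-an2-4 gates asym, D1 and NE2/3/4.  HONEST FRAMING (cell contract, verbatim): «discharging `BetaPertH` makes Bałaban's UV stability UNCONDITIONAL —
a real constructive-QFT result; it is NOT the continuum limit and NOT the Clay problem.»  ABSOLUTE RULE (cell charter, verbatim): «No internally-minted
statement may enter as a cited fact. Every hypothesis is either kernel-proved in this package or a verbatim quotation of a PUBLISHED theorem with page
reference. The manuscript(s) under audit are NOT citable for their own disputed steps — they are the thing under adjudication; programme-internal
(2001/route/tribunal) claims are never citable.»

WHY (row-D1 owner an2 gen 86, `gen86/HWD-SCOPING.md` §1 (border)).  The (W)_j letter of the `hW𝒯 j` END, through an2 g29's generic member-0 machinery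
`WardLocusRecursiveAllSlot.divW_WrecOf_zero_of_letters`, asks of the second-order border table the letter `hBord`: its divergence in the first background slot is the
commutator of the FIRST-order border table with the block generator.  At j = 0 this is an1's bond law `symBondWardB` (remainder `0`).  This file proves the KERNEL-LEVEL
composite version: for ANY bricks `(ℓ, 𝓋, 𝓋₂)` obeying the three window laws (`hℓW`, `h𝓋W` of PART 105a and `h𝓋₂W`: the second-order brick contracted with a pure gauge in its
MIDDLE slot is the first-order brick times the jump between the root and the fluctuation leg's site — an1's slot-symmetrised site law `BorderWardSiteLaw.vh2KerAt_siteWard`),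
**`compVH2Ker_div_mid`**: `Σ_κ (compVH2Ker ℓ 𝓋 𝓋₂ L m μ y f (κ, z − e_κ) b′ − compVH2Ker … f (κ, z) b′) = ([L^m•y + R m = z] − [f.2 = z]) · compVHKer ℓ 𝓋 L m μ y f b′` — induction over F5a's
four-summand chain rule `compVH2Ker_succ`, closing with PART 105a's `compLinKer_div` ∕ `compVHKer_div_right`; the level-`m` cross terms cancel pairwise (summands 1↔2, 3↔4).
PART 106b (`CompositeVertexWardRootedTwoBricks`): an1's ROOTED bricks with the slot-symmetrised second-order brick `vh2KerSymAt` (F5c) DISCHARGE `h𝓋₂W`, hence the rooted instance.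

WHAT: [folklore] finite-sum∕`tsum` induction BY NAME over an2's `compLinKer ∕ compVHKer ∕ compVH2Ker`; no `def`, no `def … : Prop`, nothing cited, 0 sorry.  Nothing of Bałaban's asserted,
valued or discharged; 0 estimates; 0∕4 row-D1 binders; (W)_j NOT claimed (this is its border letter's kernel half; packing, the mixed letter and the residual glue remain);
NOT (C1), NOT D1, NEVER «G-an2-4 closed», NOT BetaPertH, NOT continuum, NOT Clay.  Row D1 ∕ (C1) OWNER «beta-an2», gen 86, 2026-08-30.  No existing file touched.
-/

noncomputable section

open Finset
open scoped BigOperators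
open Literature.MathematicalPhysics.QuantumFieldTheory.Balaban1983to89
open Literature.MathematicalPhysics.QuantumFieldTheory.Balaban1983to89.Beta
open AffineAveraging (Site box toSite unitVec)
open AveragingHessianKernels (Bond Near)
open Summit.QuantumFields.BalabanUV.Beta.CompositeVertexKernelRec
open Summit.QuantumFields.BalabanUV.Beta.CompositeVertexWardRooted

namespace Summit.QuantumFields.BalabanUV.Beta.CompositeVertexWardRootedTwo

variable {d : ℕ}

section Generic

variable {ℓ : ℕ → Fin (d + 1) → Site (d + 1) → Bond (d + 1) → ℝ}
  {𝓋 : ℕ → Fin (d + 1) → Site (d + 1) → Bond (d + 1) → Bond (d + 1) → ℝ}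
  {𝓋₂ : ℕ → Fin (d + 1) → Site (d + 1) → Bond (d + 1) → Bond (d + 1) → Bond (d + 1) → ℝ} {L : ℕ}
  {ρ : ℕ → Site (d + 1)} {R : ℕ → Site (d + 1)}
  (hR0 : R 0 = 0) (hRs : ∀ m : ℕ, R (m + 1) = R m + ((L ^ m : ℕ) : ℤ) • ρ m)
  (hℓW : ∀ (k : ℕ) (μ : Fin (d + 1)) (y : Site (d + 1)) (G : Site (d + 1) → ℝ),
    ∑ κ : Fin (d + 1), ∑ e ∈ offs L, ℓ k μ y (κ, (L : ℤ) • y + e) * (G ((L : ℤ) • y + e + unitVec κ) - G ((L : ℤ) • y + e)) =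
      G ((L : ℤ) • y + ρ k + (L : ℤ) • unitVec μ) - G ((L : ℤ) • y + ρ k))
  (h𝓋W : ∀ (k : ℕ) (μ : Fin (d + 1)) (y : Site (d + 1)) (f : Bond (d + 1)) (G : Site (d + 1) → ℝ),
    ∑ κ : Fin (d + 1), ∑ e ∈ offs L, 𝓋 k μ y f (κ, (L : ℤ) • y + e) * (G ((L : ℤ) • y + e + unitVec κ) - G ((L : ℤ) • y + e)) =
      (G ((L : ℤ) • y + ρ k) - G f.2) * ℓ k μ y f)
  (h𝓋₂W : ∀ (k : ℕ) (μ : Fin (d + 1)) (y : Site (d + 1)) (f b' : Bond (d + 1)) (G : Site (d + 1) → ℝ),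
    ∑ κ : Fin (d + 1), ∑ e ∈ offs L, 𝓋₂ k μ y f (κ, (L : ℤ) • y + e) b' * (G ((L : ℤ) • y + e + unitVec κ) - G ((L : ℤ) • y + e)) =
      (G ((L : ℤ) • y + ρ k) - G f.2) * 𝓋 k μ y f b')

/-- [folklore] Swapping two adjacent (direction, window-offset) binder pairs. -/
theorem sum_pair_comm (L : ℕ) (F : Fin (d + 1) → Site (d + 1) → Fin (d + 1) → Site (d + 1) → ℝ) :
    ∑ κ' : Fin (d + 1), ∑ e' ∈ offs L, ∑ κ'' : Fin (d + 1), ∑ e'' ∈ offs L, F κ' e' κ'' e'' =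
      ∑ κ'' : Fin (d + 1), ∑ e'' ∈ offs L, ∑ κ' : Fin (d + 1), ∑ e' ∈ offs L, F κ' e' κ'' e'' := by
  calc ∑ κ' : Fin (d + 1), ∑ e' ∈ offs L, ∑ κ'' : Fin (d + 1), ∑ e'' ∈ offs L, F κ' e' κ'' e''
      = ∑ κ' : Fin (d + 1), ∑ κ'' : Fin (d + 1), ∑ e' ∈ offs L, ∑ e'' ∈ offs L, F κ' e' κ'' e'' :=
        Finset.sum_congr rfl fun κ' _ => Finset.sum_comm
    _ = ∑ κ'' : Fin (d + 1), ∑ κ' : Fin (d + 1), ∑ e' ∈ offs L, ∑ e'' ∈ offs L, F κ' e' κ'' e'' := Finset.sum_comm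
    _ = ∑ κ'' : Fin (d + 1), ∑ κ' : Fin (d + 1), ∑ e'' ∈ offs L, ∑ e' ∈ offs L, F κ' e' κ'' e'' :=
        Finset.sum_congr rfl fun κ'' _ => Finset.sum_congr rfl fun κ' _ => Finset.sum_comm
    _ = ∑ κ'' : Fin (d + 1), ∑ e'' ∈ offs L, ∑ κ' : Fin (d + 1), ∑ e' ∈ offs L, F κ' e' κ'' e'' :=
        Finset.sum_congr rfl fun κ'' _ => Finset.sum_comm

include hR0 hRs hℓW h𝓋W h𝓋₂W in
/-- [folklore] **THE COMPOSITE SECOND-ORDER BORDER WARD LAW (kernel level, every depth), MIDDLE SLOT**: contracted with a fine pure gauge in its FIRST background slot, the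
top-peeled composite second-order border kernel is the composite first-order vertex kernel times the leg jump between the COMPOSED ROOT and the fluctuation leg's site —
the second background leg is a spectator:
`Σ_κ (compVH2Ker m μ y f (κ, z − e_κ) b′ − compVH2Ker m μ y f (κ, z) b′) = ([L^m•y + R m = z] − [f.2 = z]) · compVHKer m μ y f b′`. -/
theorem compVH2Ker_div_mid : ∀ (m : ℕ) (μ : Fin (d + 1)) (y : Site (d + 1)) (f b' : Bond (d + 1)) (z : Site (d + 1)),
    ∑ κ : Fin (d + 1), (compVH2Ker ℓ 𝓋 𝓋₂ L m μ y f (κ, z - unitVec κ) b' - compVH2Ker ℓ 𝓋 𝓋₂ L m μ y f (κ, z) b') =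
      ((if ((L ^ m : ℕ) : ℤ) • y + R m = z then (1 : ℝ) else 0) - (if f.2 = z then (1 : ℝ) else 0)) * compVHKer ℓ 𝓋 L m μ y f b'
  | 0, μ, y, f, b', z => by
    simp only [compVH2Ker_zero, compVHKer_zero, sub_self, Finset.sum_const_zero, mul_zero]
  | m + 1, μ, y, f, b', z => by
    set G : Site (d + 1) → ℝ := fun x => if ((L ^ m : ℕ) : ℤ) • x + R m = z then (1 : ℝ) else 0 with hG
    have hLIN := compLinKer_div hR0 hRs hℓW (ℓ := ℓ)
    have hCL := compVHKer_div_right hR0 hRs hℓW h𝓋W (𝓋 := 𝓋)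
    have hIH := compVH2Ker_div_mid m
    -- summand 1: the top second-order brick along three transported bonds; divergence hits the MIDDLE transport
    have hT1 : ∑ κ₀ : Fin (d + 1),
        ((∑ κ : Fin (d + 1), ∑ e ∈ offs L, ∑ κ' : Fin (d + 1), ∑ e' ∈ offs L, ∑ κ'' : Fin (d + 1), ∑ e'' ∈ offs L,
            𝓋₂ m μ y (κ, (L : ℤ) • y + e) (κ', (L : ℤ) • y + e') (κ'', (L : ℤ) • y + e'')
              * compLinKer ℓ L m f (κ, (L : ℤ) • y + e) * compLinKer ℓ L m (κ₀, z - unitVec κ₀) (κ', (L : ℤ) • y + e')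
              * compLinKer ℓ L m b' (κ'', (L : ℤ) • y + e'')) -
          (∑ κ : Fin (d + 1), ∑ e ∈ offs L, ∑ κ' : Fin (d + 1), ∑ e' ∈ offs L, ∑ κ'' : Fin (d + 1), ∑ e'' ∈ offs L,
            𝓋₂ m μ y (κ, (L : ℤ) • y + e) (κ', (L : ℤ) • y + e') (κ'', (L : ℤ) • y + e'')
              * compLinKer ℓ L m f (κ, (L : ℤ) • y + e) * compLinKer ℓ L m (κ₀, z) (κ', (L : ℤ) • y + e')
              * compLinKer ℓ L m b' (κ'', (L : ℤ) • y + e''))) =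
        ∑ κ : Fin (d + 1), ∑ e ∈ offs L, ∑ κ'' : Fin (d + 1), ∑ e'' ∈ offs L,
          compLinKer ℓ L m f (κ, (L : ℤ) • y + e) * compLinKer ℓ L m b' (κ'', (L : ℤ) • y + e'') *
            ((G ((L : ℤ) • y + ρ m) - G ((L : ℤ) • y + e)) * 𝓋 m μ y (κ, (L : ℤ) • y + e) (κ'', (L : ℤ) • y + e'')) := by
      calc _ = ∑ κ₀ : Fin (d + 1), ∑ κ : Fin (d + 1), ∑ e ∈ offs L, ∑ κ' : Fin (d + 1), ∑ e' ∈ offs L, ∑ κ'' : Fin (d + 1), ∑ e'' ∈ offs L,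
            𝓋₂ m μ y (κ, (L : ℤ) • y + e) (κ', (L : ℤ) • y + e') (κ'', (L : ℤ) • y + e'')
              * compLinKer ℓ L m f (κ, (L : ℤ) • y + e) * compLinKer ℓ L m b' (κ'', (L : ℤ) • y + e'') *
              (compLinKer ℓ L m (κ₀, z - unitVec κ₀) (κ', (L : ℤ) • y + e') - compLinKer ℓ L m (κ₀, z) (κ', (L : ℤ) • y + e')) := by
            refine Finset.sum_congr rfl fun κ₀ _ => ?_
            simp only [← Finset.sum_sub_distrib]
            refine Finset.sum_congr rfl fun κ _ => Finset.sum_congr rfl fun e _ => Finset.sum_congr rfl fun κ' _ =>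
              Finset.sum_congr rfl fun e' _ => Finset.sum_congr rfl fun κ'' _ => Finset.sum_congr rfl fun e'' _ => ?_
            ring
        _ = ∑ κ : Fin (d + 1), ∑ e ∈ offs L, ∑ κ' : Fin (d + 1), ∑ e' ∈ offs L, ∑ κ'' : Fin (d + 1), ∑ e'' ∈ offs L, ∑ κ₀ : Fin (d + 1),
            𝓋₂ m μ y (κ, (L : ℤ) • y + e) (κ', (L : ℤ) • y + e') (κ'', (L : ℤ) • y + e'')
              * compLinKer ℓ L m f (κ, (L : ℤ) • y + e) * compLinKer ℓ L m b' (κ'', (L : ℤ) • y + e'') *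
              (compLinKer ℓ L m (κ₀, z - unitVec κ₀) (κ', (L : ℤ) • y + e') - compLinKer ℓ L m (κ₀, z) (κ', (L : ℤ) • y + e')) := by
            rw [Finset.sum_comm]
            refine Finset.sum_congr rfl fun κ _ => ?_
            rw [Finset.sum_comm]
            refine Finset.sum_congr rfl fun e _ => ?_
            rw [Finset.sum_comm]
            refine Finset.sum_congr rfl fun κ' _ => ?_
            rw [Finset.sum_comm]
            refine Finset.sum_congr rfl fun e' _ => ?_
            rw [Finset.sum_comm]
            refine Finset.sum_congr rfl fun κ'' _ => ?_
            rw [Finset.sum_comm]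
        _ = ∑ κ : Fin (d + 1), ∑ e ∈ offs L, ∑ κ' : Fin (d + 1), ∑ e' ∈ offs L, ∑ κ'' : Fin (d + 1), ∑ e'' ∈ offs L,
            𝓋₂ m μ y (κ, (L : ℤ) • y + e) (κ', (L : ℤ) • y + e') (κ'', (L : ℤ) • y + e'')
              * compLinKer ℓ L m f (κ, (L : ℤ) • y + e) * compLinKer ℓ L m b' (κ'', (L : ℤ) • y + e'') *
              (G ((L : ℤ) • y + e' + unitVec κ') - G ((L : ℤ) • y + e')) := by
            refine Finset.sum_congr rfl fun κ _ => Finset.sum_congr rfl fun e _ => Finset.sum_congr rfl fun κ' _ =>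
              Finset.sum_congr rfl fun e' _ => Finset.sum_congr rfl fun κ'' _ => Finset.sum_congr rfl fun e'' _ => ?_
            rw [← Finset.mul_sum, hLIN m (κ', (L : ℤ) • y + e') z]
        _ = ∑ κ : Fin (d + 1), ∑ e ∈ offs L, compLinKer ℓ L m f (κ, (L : ℤ) • y + e) *
            ∑ κ'' : Fin (d + 1), ∑ e'' ∈ offs L, compLinKer ℓ L m b' (κ'', (L : ℤ) • y + e'') *
              ∑ κ' : Fin (d + 1), ∑ e' ∈ offs L, 𝓋₂ m μ y (κ, (L : ℤ) • y + e) (κ', (L : ℤ) • y + e') (κ'', (L : ℤ) • y + e'') *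
                (G ((L : ℤ) • y + e' + unitVec κ') - G ((L : ℤ) • y + e')) := by
            refine Finset.sum_congr rfl fun κ _ => Finset.sum_congr rfl fun e _ => ?_
            rw [sum_pair_comm L (fun κ' e' κ'' e'' =>
              𝓋₂ m μ y (κ, (L : ℤ) • y + e) (κ', (L : ℤ) • y + e') (κ'', (L : ℤ) • y + e'')
                * compLinKer ℓ L m f (κ, (L : ℤ) • y + e) * compLinKer ℓ L m b' (κ'', (L : ℤ) • y + e'') *
                (G ((L : ℤ) • y + e' + unitVec κ') - G ((L : ℤ) • y + e'))), Finset.mul_sum]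
            refine Finset.sum_congr rfl fun κ'' _ => ?_
            rw [Finset.mul_sum]
            refine Finset.sum_congr rfl fun e'' _ => ?_
            rw [Finset.mul_sum, Finset.mul_sum]
            refine Finset.sum_congr rfl fun κ' _ => ?_
            rw [Finset.mul_sum, Finset.mul_sum]
            refine Finset.sum_congr rfl fun e' _ => ?_
            ring
        _ = _ := by
            refine Finset.sum_congr rfl fun κ _ => Finset.sum_congr rfl fun e _ => ?_
            rw [Finset.mul_sum]
            refine Finset.sum_congr rfl fun κ'' _ => ?_
            rw [Finset.mul_sum]
            refine Finset.sum_congr rfl fun e'' _ => ?_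
            rw [h𝓋₂W m μ y (κ, (L : ℤ) • y + e) (κ'', (L : ℤ) • y + e'') G]
            ring
    -- summand 2: the top first-order brick; divergence hits the depth-`m` composite vertex in `(f, b)` (PART 105a `compVHKer_div_right`)
    have hT2 : ∑ κ₀ : Fin (d + 1),
        ((∑ κ : Fin (d + 1), ∑ e ∈ offs L, ∑ κ'' : Fin (d + 1), ∑ e'' ∈ offs L,
            𝓋 m μ y (κ, (L : ℤ) • y + e) (κ'', (L : ℤ) • y + e'')
              * compVHKer ℓ 𝓋 L m κ ((L : ℤ) • y + e) f (κ₀, z - unitVec κ₀) * compLinKer ℓ L m b' (κ'', (L : ℤ) • y + e'')) -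
          (∑ κ : Fin (d + 1), ∑ e ∈ offs L, ∑ κ'' : Fin (d + 1), ∑ e'' ∈ offs L,
            𝓋 m μ y (κ, (L : ℤ) • y + e) (κ'', (L : ℤ) • y + e'')
              * compVHKer ℓ 𝓋 L m κ ((L : ℤ) • y + e) f (κ₀, z) * compLinKer ℓ L m b' (κ'', (L : ℤ) • y + e''))) =
        ∑ κ : Fin (d + 1), ∑ e ∈ offs L, ∑ κ'' : Fin (d + 1), ∑ e'' ∈ offs L,
          compLinKer ℓ L m f (κ, (L : ℤ) • y + e) * compLinKer ℓ L m b' (κ'', (L : ℤ) • y + e'') *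
            ((G ((L : ℤ) • y + e) - (if f.2 = z then (1 : ℝ) else 0)) * 𝓋 m μ y (κ, (L : ℤ) • y + e) (κ'', (L : ℤ) • y + e'')) := by
      calc _ = ∑ κ₀ : Fin (d + 1), ∑ κ : Fin (d + 1), ∑ e ∈ offs L, ∑ κ'' : Fin (d + 1), ∑ e'' ∈ offs L,
            𝓋 m μ y (κ, (L : ℤ) • y + e) (κ'', (L : ℤ) • y + e'') * compLinKer ℓ L m b' (κ'', (L : ℤ) • y + e'') *
              (compVHKer ℓ 𝓋 L m κ ((L : ℤ) • y + e) f (κ₀, z - unitVec κ₀) - compVHKer ℓ 𝓋 L m κ ((L : ℤ) • y + e) f (κ₀, z)) := by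
            refine Finset.sum_congr rfl fun κ₀ _ => ?_
            simp only [← Finset.sum_sub_distrib]
            refine Finset.sum_congr rfl fun κ _ => Finset.sum_congr rfl fun e _ => Finset.sum_congr rfl fun κ'' _ => Finset.sum_congr rfl fun e'' _ => ?_
            ring
        _ = ∑ κ : Fin (d + 1), ∑ e ∈ offs L, ∑ κ'' : Fin (d + 1), ∑ e'' ∈ offs L, ∑ κ₀ : Fin (d + 1),
            𝓋 m μ y (κ, (L : ℤ) • y + e) (κ'', (L : ℤ) • y + e'') * compLinKer ℓ L m b' (κ'', (L : ℤ) • y + e'') *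
              (compVHKer ℓ 𝓋 L m κ ((L : ℤ) • y + e) f (κ₀, z - unitVec κ₀) - compVHKer ℓ 𝓋 L m κ ((L : ℤ) • y + e) f (κ₀, z)) := by
            rw [Finset.sum_comm]
            refine Finset.sum_congr rfl fun κ _ => ?_
            rw [Finset.sum_comm]
            refine Finset.sum_congr rfl fun e _ => ?_
            rw [Finset.sum_comm]
            refine Finset.sum_congr rfl fun κ'' _ => ?_
            rw [Finset.sum_comm]
        _ = _ := by
            refine Finset.sum_congr rfl fun κ _ => Finset.sum_congr rfl fun e _ => Finset.sum_congr rfl fun κ'' _ => Finset.sum_congr rfl fun e'' _ => ?_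
            rw [← Finset.mul_sum, hCL m κ ((L : ℤ) • y + e) f z]
            ring
    -- summand 3: the top first-order brick; divergence hits the transport of the first background bond (window law `h𝓋W`)
    have hT3 : ∑ κ₀ : Fin (d + 1),
        ((∑ κ : Fin (d + 1), ∑ e ∈ offs L, ∑ κ' : Fin (d + 1), ∑ e' ∈ offs L,
            𝓋 m μ y (κ, (L : ℤ) • y + e) (κ', (L : ℤ) • y + e')
              * compVHKer ℓ 𝓋 L m κ ((L : ℤ) • y + e) f b' * compLinKer ℓ L m (κ₀, z - unitVec κ₀) (κ', (L : ℤ) • y + e')) -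
          (∑ κ : Fin (d + 1), ∑ e ∈ offs L, ∑ κ' : Fin (d + 1), ∑ e' ∈ offs L,
            𝓋 m μ y (κ, (L : ℤ) • y + e) (κ', (L : ℤ) • y + e')
              * compVHKer ℓ 𝓋 L m κ ((L : ℤ) • y + e) f b' * compLinKer ℓ L m (κ₀, z) (κ', (L : ℤ) • y + e'))) =
        ∑ κ : Fin (d + 1), ∑ e ∈ offs L, compVHKer ℓ 𝓋 L m κ ((L : ℤ) • y + e) f b' *
          ((G ((L : ℤ) • y + ρ m) - G ((L : ℤ) • y + e)) * ℓ m μ y (κ, (L : ℤ) • y + e)) := by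
      calc _ = ∑ κ₀ : Fin (d + 1), ∑ κ : Fin (d + 1), ∑ e ∈ offs L, ∑ κ' : Fin (d + 1), ∑ e' ∈ offs L,
            compVHKer ℓ 𝓋 L m κ ((L : ℤ) • y + e) f b' * 𝓋 m μ y (κ, (L : ℤ) • y + e) (κ', (L : ℤ) • y + e') *
              (compLinKer ℓ L m (κ₀, z - unitVec κ₀) (κ', (L : ℤ) • y + e') - compLinKer ℓ L m (κ₀, z) (κ', (L : ℤ) • y + e')) := by
            refine Finset.sum_congr rfl fun κ₀ _ => ?_
            simp only [← Finset.sum_sub_distrib]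
            refine Finset.sum_congr rfl fun κ _ => Finset.sum_congr rfl fun e _ => Finset.sum_congr rfl fun κ' _ => Finset.sum_congr rfl fun e' _ => ?_
            ring
        _ = ∑ κ : Fin (d + 1), ∑ e ∈ offs L, ∑ κ' : Fin (d + 1), ∑ e' ∈ offs L, ∑ κ₀ : Fin (d + 1),
            compVHKer ℓ 𝓋 L m κ ((L : ℤ) • y + e) f b' * 𝓋 m μ y (κ, (L : ℤ) • y + e) (κ', (L : ℤ) • y + e') *
              (compLinKer ℓ L m (κ₀, z - unitVec κ₀) (κ', (L : ℤ) • y + e') - compLinKer ℓ L m (κ₀, z) (κ', (L : ℤ) • y + e')) := by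
            rw [Finset.sum_comm]
            refine Finset.sum_congr rfl fun κ _ => ?_
            rw [Finset.sum_comm]
            refine Finset.sum_congr rfl fun e _ => ?_
            rw [Finset.sum_comm]
            refine Finset.sum_congr rfl fun κ' _ => ?_
            rw [Finset.sum_comm]
        _ = ∑ κ : Fin (d + 1), ∑ e ∈ offs L, compVHKer ℓ 𝓋 L m κ ((L : ℤ) • y + e) f b' *
            ∑ κ' : Fin (d + 1), ∑ e' ∈ offs L, 𝓋 m μ y (κ, (L : ℤ) • y + e) (κ', (L : ℤ) • y + e') *
              (G ((L : ℤ) • y + e' + unitVec κ') - G ((L : ℤ) • y + e')) := by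
            refine Finset.sum_congr rfl fun κ _ => Finset.sum_congr rfl fun e _ => ?_
            rw [Finset.mul_sum]
            refine Finset.sum_congr rfl fun κ' _ => ?_
            rw [Finset.mul_sum]
            refine Finset.sum_congr rfl fun e' _ => ?_
            rw [← Finset.mul_sum, hLIN m (κ', (L : ℤ) • y + e') z]
            ring
        _ = _ := by
            refine Finset.sum_congr rfl fun κ _ => Finset.sum_congr rfl fun e _ => ?_
            rw [h𝓋W m μ y (κ, (L : ℤ) • y + e) G]
    -- summand 4: the top linear brick over the depth-`m` composite second-order kernel (induction hypothesis)
    have hT4 : ∑ κ₀ : Fin (d + 1),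
        ((∑ κ : Fin (d + 1), ∑ e ∈ offs L, ℓ m μ y (κ, (L : ℤ) • y + e) * compVH2Ker ℓ 𝓋 𝓋₂ L m κ ((L : ℤ) • y + e) f (κ₀, z - unitVec κ₀) b') -
          (∑ κ : Fin (d + 1), ∑ e ∈ offs L, ℓ m μ y (κ, (L : ℤ) • y + e) * compVH2Ker ℓ 𝓋 𝓋₂ L m κ ((L : ℤ) • y + e) f (κ₀, z) b')) =
        ∑ κ : Fin (d + 1), ∑ e ∈ offs L, ℓ m μ y (κ, (L : ℤ) • y + e) *
          ((G ((L : ℤ) • y + e) - (if f.2 = z then (1 : ℝ) else 0)) * compVHKer ℓ 𝓋 L m κ ((L : ℤ) • y + e) f b') := by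
      calc _ = ∑ κ₀ : Fin (d + 1), ∑ κ : Fin (d + 1), ∑ e ∈ offs L, ℓ m μ y (κ, (L : ℤ) • y + e) *
            (compVH2Ker ℓ 𝓋 𝓋₂ L m κ ((L : ℤ) • y + e) f (κ₀, z - unitVec κ₀) b' - compVH2Ker ℓ 𝓋 𝓋₂ L m κ ((L : ℤ) • y + e) f (κ₀, z) b') := by
            refine Finset.sum_congr rfl fun κ₀ _ => ?_
            simp only [← Finset.sum_sub_distrib, ← mul_sub]
        _ = ∑ κ : Fin (d + 1), ∑ e ∈ offs L, ∑ κ₀ : Fin (d + 1), ℓ m μ y (κ, (L : ℤ) • y + e) *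
            (compVH2Ker ℓ 𝓋 𝓋₂ L m κ ((L : ℤ) • y + e) f (κ₀, z - unitVec κ₀) b' - compVH2Ker ℓ 𝓋 𝓋₂ L m κ ((L : ℤ) • y + e) f (κ₀, z) b') := by
            rw [Finset.sum_comm]
            refine Finset.sum_congr rfl fun κ _ => ?_
            rw [Finset.sum_comm]
        _ = _ := by
            refine Finset.sum_congr rfl fun κ _ => Finset.sum_congr rfl fun e _ => ?_
            rw [← Finset.mul_sum, hIH κ ((L : ℤ) • y + e) f b' z]
    -- the root read one level up
    have hroot : G ((L : ℤ) • y + ρ m) = if ((L ^ (m + 1) : ℕ) : ℤ) • y + R (m + 1) = z then (1 : ℝ) else 0 := by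
      have e2 : ((L ^ m : ℕ) : ℤ) • ((L : ℤ) • y + ρ m) + R m = ((L ^ (m + 1) : ℕ) : ℤ) • y + R (m + 1) := by
        rw [hRs m]; push_cast; simp only [smul_add, smul_smul, pow_succ]; abel
      simp only [hG, e2]
    -- assemble: cross terms cancel (1↔2, 3↔4)
    calc ∑ κ₀ : Fin (d + 1), (compVH2Ker ℓ 𝓋 𝓋₂ L (m + 1) μ y f (κ₀, z - unitVec κ₀) b' - compVH2Ker ℓ 𝓋 𝓋₂ L (m + 1) μ y f (κ₀, z) b')
        = (∑ κ₀ : Fin (d + 1),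
            ((∑ κ : Fin (d + 1), ∑ e ∈ offs L, ∑ κ' : Fin (d + 1), ∑ e' ∈ offs L, ∑ κ'' : Fin (d + 1), ∑ e'' ∈ offs L,
                𝓋₂ m μ y (κ, (L : ℤ) • y + e) (κ', (L : ℤ) • y + e') (κ'', (L : ℤ) • y + e'')
                  * compLinKer ℓ L m f (κ, (L : ℤ) • y + e) * compLinKer ℓ L m (κ₀, z - unitVec κ₀) (κ', (L : ℤ) • y + e')
                  * compLinKer ℓ L m b' (κ'', (L : ℤ) • y + e'')) -
              (∑ κ : Fin (d + 1), ∑ e ∈ offs L, ∑ κ' : Fin (d + 1), ∑ e' ∈ offs L, ∑ κ'' : Fin (d + 1), ∑ e'' ∈ offs L,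
                𝓋₂ m μ y (κ, (L : ℤ) • y + e) (κ', (L : ℤ) • y + e') (κ'', (L : ℤ) • y + e'')
                  * compLinKer ℓ L m f (κ, (L : ℤ) • y + e) * compLinKer ℓ L m (κ₀, z) (κ', (L : ℤ) • y + e')
                  * compLinKer ℓ L m b' (κ'', (L : ℤ) • y + e'')))) +
          (∑ κ₀ : Fin (d + 1),
            ((∑ κ : Fin (d + 1), ∑ e ∈ offs L, ∑ κ'' : Fin (d + 1), ∑ e'' ∈ offs L,
                𝓋 m μ y (κ, (L : ℤ) • y + e) (κ'', (L : ℤ) • y + e'')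
                  * compVHKer ℓ 𝓋 L m κ ((L : ℤ) • y + e) f (κ₀, z - unitVec κ₀) * compLinKer ℓ L m b' (κ'', (L : ℤ) • y + e'')) -
              (∑ κ : Fin (d + 1), ∑ e ∈ offs L, ∑ κ'' : Fin (d + 1), ∑ e'' ∈ offs L,
                𝓋 m μ y (κ, (L : ℤ) • y + e) (κ'', (L : ℤ) • y + e'')
                  * compVHKer ℓ 𝓋 L m κ ((L : ℤ) • y + e) f (κ₀, z) * compLinKer ℓ L m b' (κ'', (L : ℤ) • y + e'')))) +
          (∑ κ₀ : Fin (d + 1),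
            ((∑ κ : Fin (d + 1), ∑ e ∈ offs L, ∑ κ' : Fin (d + 1), ∑ e' ∈ offs L,
                𝓋 m μ y (κ, (L : ℤ) • y + e) (κ', (L : ℤ) • y + e')
                  * compVHKer ℓ 𝓋 L m κ ((L : ℤ) • y + e) f b' * compLinKer ℓ L m (κ₀, z - unitVec κ₀) (κ', (L : ℤ) • y + e')) -
              (∑ κ : Fin (d + 1), ∑ e ∈ offs L, ∑ κ' : Fin (d + 1), ∑ e' ∈ offs L,
                𝓋 m μ y (κ, (L : ℤ) • y + e) (κ', (L : ℤ) • y + e')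
                  * compVHKer ℓ 𝓋 L m κ ((L : ℤ) • y + e) f b' * compLinKer ℓ L m (κ₀, z) (κ', (L : ℤ) • y + e')))) +
          ∑ κ₀ : Fin (d + 1),
            ((∑ κ : Fin (d + 1), ∑ e ∈ offs L, ℓ m μ y (κ, (L : ℤ) • y + e) * compVH2Ker ℓ 𝓋 𝓋₂ L m κ ((L : ℤ) • y + e) f (κ₀, z - unitVec κ₀) b') -
              (∑ κ : Fin (d + 1), ∑ e ∈ offs L, ℓ m μ y (κ, (L : ℤ) • y + e) * compVH2Ker ℓ 𝓋 𝓋₂ L m κ ((L : ℤ) • y + e) f (κ₀, z) b')) := by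
          rw [← Finset.sum_add_distrib, ← Finset.sum_add_distrib, ← Finset.sum_add_distrib]
          refine Finset.sum_congr rfl fun κ₀ _ => ?_
          rw [compVH2Ker_succ, compVH2Ker_succ]
          ring
      _ = (∑ κ : Fin (d + 1), ∑ e ∈ offs L, ∑ κ'' : Fin (d + 1), ∑ e'' ∈ offs L,
            compLinKer ℓ L m f (κ, (L : ℤ) • y + e) * compLinKer ℓ L m b' (κ'', (L : ℤ) • y + e'') *
              ((G ((L : ℤ) • y + ρ m) - G ((L : ℤ) • y + e)) * 𝓋 m μ y (κ, (L : ℤ) • y + e) (κ'', (L : ℤ) • y + e''))) +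
          (∑ κ : Fin (d + 1), ∑ e ∈ offs L, ∑ κ'' : Fin (d + 1), ∑ e'' ∈ offs L,
            compLinKer ℓ L m f (κ, (L : ℤ) • y + e) * compLinKer ℓ L m b' (κ'', (L : ℤ) • y + e'') *
              ((G ((L : ℤ) • y + e) - (if f.2 = z then (1 : ℝ) else 0)) * 𝓋 m μ y (κ, (L : ℤ) • y + e) (κ'', (L : ℤ) • y + e''))) +
          (∑ κ : Fin (d + 1), ∑ e ∈ offs L, compVHKer ℓ 𝓋 L m κ ((L : ℤ) • y + e) f b' *
            ((G ((L : ℤ) • y + ρ m) - G ((L : ℤ) • y + e)) * ℓ m μ y (κ, (L : ℤ) • y + e))) +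
          ∑ κ : Fin (d + 1), ∑ e ∈ offs L, ℓ m μ y (κ, (L : ℤ) • y + e) *
            ((G ((L : ℤ) • y + e) - (if f.2 = z then (1 : ℝ) else 0)) * compVHKer ℓ 𝓋 L m κ ((L : ℤ) • y + e) f b') := by
          rw [hT1, hT2, hT3, hT4]
      _ = (G ((L : ℤ) • y + ρ m) - (if f.2 = z then (1 : ℝ) else 0)) *
            ((∑ κ : Fin (d + 1), ∑ e ∈ offs L, ∑ κ'' : Fin (d + 1), ∑ e'' ∈ offs L,
                𝓋 m μ y (κ, (L : ℤ) • y + e) (κ'', (L : ℤ) • y + e'') *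
                  compLinKer ℓ L m f (κ, (L : ℤ) • y + e) * compLinKer ℓ L m b' (κ'', (L : ℤ) • y + e'')) +
              ∑ κ : Fin (d + 1), ∑ e ∈ offs L, ℓ m μ y (κ, (L : ℤ) • y + e) * compVHKer ℓ 𝓋 L m κ ((L : ℤ) • y + e) f b') := by
          have h12 : (∑ κ : Fin (d + 1), ∑ e ∈ offs L, ∑ κ'' : Fin (d + 1), ∑ e'' ∈ offs L,
              compLinKer ℓ L m f (κ, (L : ℤ) • y + e) * compLinKer ℓ L m b' (κ'', (L : ℤ) • y + e'') *
                ((G ((L : ℤ) • y + ρ m) - G ((L : ℤ) • y + e)) * 𝓋 m μ y (κ, (L : ℤ) • y + e) (κ'', (L : ℤ) • y + e''))) +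
              (∑ κ : Fin (d + 1), ∑ e ∈ offs L, ∑ κ'' : Fin (d + 1), ∑ e'' ∈ offs L,
              compLinKer ℓ L m f (κ, (L : ℤ) • y + e) * compLinKer ℓ L m b' (κ'', (L : ℤ) • y + e'') *
                ((G ((L : ℤ) • y + e) - (if f.2 = z then (1 : ℝ) else 0)) * 𝓋 m μ y (κ, (L : ℤ) • y + e) (κ'', (L : ℤ) • y + e''))) =
              (G ((L : ℤ) • y + ρ m) - (if f.2 = z then (1 : ℝ) else 0)) *
                ∑ κ : Fin (d + 1), ∑ e ∈ offs L, ∑ κ'' : Fin (d + 1), ∑ e'' ∈ offs L,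
                  𝓋 m μ y (κ, (L : ℤ) • y + e) (κ'', (L : ℤ) • y + e'') *
                    compLinKer ℓ L m f (κ, (L : ℤ) • y + e) * compLinKer ℓ L m b' (κ'', (L : ℤ) • y + e'') := by
            rw [Finset.mul_sum, ← Finset.sum_add_distrib]
            refine Finset.sum_congr rfl fun κ _ => ?_
            rw [Finset.mul_sum, ← Finset.sum_add_distrib]
            refine Finset.sum_congr rfl fun e _ => ?_
            rw [Finset.mul_sum, ← Finset.sum_add_distrib]
            refine Finset.sum_congr rfl fun κ'' _ => ?_
            rw [Finset.mul_sum, ← Finset.sum_add_distrib]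
            refine Finset.sum_congr rfl fun e'' _ => ?_
            ring
          have h34 : (∑ κ : Fin (d + 1), ∑ e ∈ offs L, compVHKer ℓ 𝓋 L m κ ((L : ℤ) • y + e) f b' *
              ((G ((L : ℤ) • y + ρ m) - G ((L : ℤ) • y + e)) * ℓ m μ y (κ, (L : ℤ) • y + e))) +
              (∑ κ : Fin (d + 1), ∑ e ∈ offs L, ℓ m μ y (κ, (L : ℤ) • y + e) *
              ((G ((L : ℤ) • y + e) - (if f.2 = z then (1 : ℝ) else 0)) * compVHKer ℓ 𝓋 L m κ ((L : ℤ) • y + e) f b')) =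
              (G ((L : ℤ) • y + ρ m) - (if f.2 = z then (1 : ℝ) else 0)) *
                ∑ κ : Fin (d + 1), ∑ e ∈ offs L, ℓ m μ y (κ, (L : ℤ) • y + e) * compVHKer ℓ 𝓋 L m κ ((L : ℤ) • y + e) f b' := by
            rw [Finset.mul_sum, ← Finset.sum_add_distrib]
            refine Finset.sum_congr rfl fun κ _ => ?_
            rw [Finset.mul_sum, ← Finset.sum_add_distrib]
            refine Finset.sum_congr rfl fun e _ => ?_
            ring
          rw [add_assoc, h12, h34, ← mul_add]
      _ = _ := by rw [hroot, compVHKer_succ]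

end Generic


end Summit.QuantumFields.BalabanUV.Beta.CompositeVertexWardRootedTwo

end
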